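import Summits.QuantumFields.BalabanUV.T4Continuum.Support.DirichletTubeDecay

/-!
# `BalabanUV.T4Continuum.Support.LongitudinalRamp` — NE2 (node U1a) formalisation swarm, sub-row `T4-U1a.S-NE2-D1-DIRICHLET°`, supplier item
# «Δ1-HOLEFILL» (tube decay, part 5): THE LONGITUDINAL PROFILE of the tube cutoff as a lattice ramp — the 1-D push-forward of
# `DirichletHoleFillingCutoff.ramp` along the direction `μ₀`, its zone, and `tube_decay` with the profile hypotheses DISCHARGED
# (unit b2b-balaban-t4-ne2-formalise-leaf-08, gen 6, file 15)

HONEST FRAMING.  Rung (B)+1 bookkeeping at MODEL level; [folklore]; NE2 (U1a) is NOT proved by this file; spine PROVED 0/9 unchanged; NOT infinite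
volume, NOT the mass gap, NOT Clay.  HONEST DEPENDENCY (verbatim): «continuum YM on T⁴ ⇐ BetaPertH ∧ nine spine estimates (0/9 proved); BetaPertH ⇐
(D1) ∧ (D4) ∧ CAP+tail; G-an2-4 gates asym, D1 and NE2/3/4.»

WHAT THIS FILE PROVES (0 sorry).  For `4k_L = n_L + 1 ≤ N μ₀`, `k_L ≥ 2`, a start `t₀ : ZMod (N μ₀)`: the 1-D chart `lchart t₀ s = t₀ + s`, the profile
`phiL t = Σ_s [t₀ + s = t]·ramp k_L s` and the zone `zoneL = image of lchart`: `phiL_lchart`, `phiL_nonneg`, `phiL_le_one`, `mem_zone_of_phiL_ne_zero`,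
`phiL_diff` (the bond difference is the push-forward of the ramp differences; first and last positions carry `ramp = 0`), `abs_phiL_diff_le`
(`≤ 1/(k_L − 1)`), `mem_zone_of_phiL_diff_ne` (both ends in the zone), `phiL_eq_one` on the plateau `t₀ + s`, `k_L − 1 ≤ s ≤ 3k_L`; and
**`tube_decay_ramp`** = `DirichletTubeDecay.tube_decay` with `φ = phiL`, `ℓ = 1/(k_L − 1)`, `S = zoneL` — the only remaining hypothesis on the
field is the vanishing of the slices `t ∈ zoneL` on the transversal chart octant (an exterior block along the edge).

ABSOLUTE RULE (cell, verbatim): «No internally-minted statement may enter as a cited fact. Every hypothesis is either kernel-proved in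
this package or a verbatim quotation of a PUBLISHED theorem with page reference. The manuscript(s) under audit are NOT citable for
their own disputed steps — they are the thing under adjudication; programme-internal (2001/route/tribunal) claims are never citable.»
[folklore]; plain data `def`s (`lchart`, `phiL`, `zoneL`), no `def … : Prop` fact.  NOT CLAIMED: the blockReg ∕ solExt instance for tubes; NE2.
-/

noncomputable section

open scoped BigOperators ComplexConjugate Matrix
open Finset

namespace Summit.QuantumFields.BalabanUV.T4Continuum.LongitudinalRamp

open Literature.MathematicalPhysics.QuantumFieldTheory.Balaban1983to89.B5Prop11Plancherel (Tor)
open Literature.MathematicalPhysics.QuantumFieldTheory.Balaban1983to89.B5Action121 (LapS)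
open Summit.QuantumFields.BalabanUV.T4Continuum.DirichletDirectionalBesov (restrictTo)
open Summit.QuantumFields.BalabanUV.T4Continuum.CoordSlabPoincare (dirOn)
open Summit.QuantumFields.BalabanUV.T4Continuum.CoordOctantBoxes (oct)
open Summit.QuantumFields.BalabanUV.T4Continuum.DirichletHoleFillingCutoff (chart ramp ramp_nonneg ramp_le_one ramp_eq_one ramp_zero ramp_last
  abs_ramp_sub_le)
open Summit.QuantumFields.BalabanUV.T4Continuum.DirichletHoleFilling (theta)
open Summit.QuantumFields.BalabanUV.T4Continuum.DirichletMorreyDecay (shift)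
open Summit.QuantumFields.BalabanUV.T4Continuum.TorusSlicing (Nsl ins zsl)
open Summit.QuantumFields.BalabanUV.T4Continuum.DirichletTubeDecay (tube_decay)

variable {d : ℕ} (N : Fin (d + 1) → ℕ) [hN : ∀ μ, NeZero (N μ)] (μ₀ : Fin (d + 1)) (kL : ℕ) {nL : ℕ} (t₀ : ZMod (N μ₀))

/-- the 1-D longitudinal chart `s ↦ t₀ + s`. [folklore] -/
def lchart (s : Fin (nL + 1)) : ZMod (N μ₀) := t₀ + ((s : ℕ) : ZMod (N μ₀))

/-- the LONGITUDINAL PROFILE: the push-forward of `ramp k_L` along the chart. [folklore] -/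
def phiL (t : ZMod (N μ₀)) : ℝ := ∑ s : Fin (nL + 1), if lchart N μ₀ (nL := nL) t₀ s = t then ramp kL (s : ℕ) else 0

/-- the ZONE: the image of the chart. [folklore] -/
def zoneL : Finset (ZMod (N μ₀)) := univ.image (lchart N μ₀ (nL := nL) t₀)

omit hN in
/-- the chart is injective once it fits (`n_L + 1 ≤ N μ₀`). [folklore] -/
theorem lchart_injective (hfit : nL + 1 ≤ N μ₀) : Function.Injective (lchart N μ₀ (nL := nL) t₀) := by
  intro s s' h
  simp only [lchart, add_right_inj] at h
  have h2 := congrArg ZMod.val h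
  rw [ZMod.val_natCast_of_lt (lt_of_lt_of_le s.isLt hfit), ZMod.val_natCast_of_lt (lt_of_lt_of_le s'.isLt hfit)] at h2
  exact Fin.ext h2

omit hN in
/-- the profile on the chart. [folklore] -/
theorem phiL_lchart (hfit : nL + 1 ≤ N μ₀) (s : Fin (nL + 1)) : phiL N μ₀ kL (nL := nL) t₀ (lchart N μ₀ (nL := nL) t₀ s) = ramp kL (s : ℕ) := by
  rw [phiL, Finset.sum_eq_single s (fun s' _ hne => if_neg (fun h => hne (lchart_injective N μ₀ t₀ hfit h))) (fun h => absurd (mem_univ s) h),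
    if_pos rfl]

omit hN in
/-- off the chart the profile vanishes. [folklore] -/
theorem phiL_eq_zero_of_forall_ne {t : ZMod (N μ₀)} (h : ∀ s, lchart N μ₀ (nL := nL) t₀ s ≠ t) : phiL N μ₀ kL (nL := nL) t₀ t = 0 :=
  Finset.sum_eq_zero fun s _ => if_neg (h s)

omit hN in
/-- `0 ≤ phiL` (for `4k_L = n_L + 1`, `k_L ≥ 2`). [folklore] -/
theorem phiL_nonneg (hk : 2 ≤ kL) (hnL : 4 * kL = nL + 1) (t : ZMod (N μ₀)) : 0 ≤ phiL N μ₀ kL (nL := nL) t₀ t :=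
  Finset.sum_nonneg fun s _ => by split_ifs; exacts [ramp_nonneg kL hk (by have := s.isLt; omega), le_rfl]

omit hN in
/-- `phiL ≤ 1`. [folklore] -/
theorem phiL_le_one (hfit : nL + 1 ≤ N μ₀) (t : ZMod (N μ₀)) : phiL N μ₀ kL (nL := nL) t₀ t ≤ 1 := by
  by_cases h : ∃ s : Fin (nL + 1), lchart N μ₀ (nL := nL) t₀ s = t
  · obtain ⟨s, rfl⟩ := h
    rw [phiL_lchart N μ₀ kL t₀ hfit]; exact ramp_le_one kL _
  · push Not at h
    rw [phiL_eq_zero_of_forall_ne N μ₀ kL t₀ h]; exact zero_le_one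

omit hN in
/-- a non-zero value lies in the zone. [folklore] -/
theorem mem_zone_of_phiL_ne_zero {t : ZMod (N μ₀)} (h : phiL N μ₀ kL (nL := nL) t₀ t ≠ 0) : t ∈ zoneL N μ₀ (nL := nL) t₀ := by
  by_contra hz
  apply h
  refine phiL_eq_zero_of_forall_ne N μ₀ kL t₀ fun s hs => hz ?_
  rw [zoneL, mem_image]; exact ⟨s, mem_univ _, hs⟩

omit hN in
/-- `lchart (s+1) = lchart s + 1` off the last position. [folklore] -/
theorem lchart_succ {s : Fin (nL + 1)} (hs : s ≠ Fin.last nL) :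
    lchart N μ₀ (nL := nL) t₀ (s + 1) = lchart N μ₀ (nL := nL) t₀ s + 1 := by
  rw [lchart, lchart, Fin.val_add_one_of_lt (Fin.lt_last_iff_ne_last.mpr hs), Nat.cast_succ, add_assoc]

omit hN in
/-- **THE BOND DIFFERENCE OF THE PROFILE** is the push-forward of the ramp differences (the first and last positions carry `ramp = 0`). [folklore] -/
theorem phiL_diff (hk : 2 ≤ kL) (hnL : 4 * kL = nL + 1) (hfit : nL + 1 ≤ N μ₀) (t : ZMod (N μ₀)) :
    phiL N μ₀ kL (nL := nL) t₀ (t + 1) - phiL N μ₀ kL (nL := nL) t₀ t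
      = ∑ s ∈ univ.filter (fun s : Fin (nL + 1) => s ≠ Fin.last nL),
          (if lchart N μ₀ (nL := nL) t₀ s = t then ramp kL ((s : ℕ) + 1) - ramp kL (s : ℕ) else 0) := by
  have hinj := lchart_injective N μ₀ t₀ hfit
  -- `phiL (t+1)`: drop `s = 0`, reindex `s = s' + 1`
  have h1 : phiL N μ₀ kL (nL := nL) t₀ (t + 1)
      = ∑ s ∈ univ.filter (fun s : Fin (nL + 1) => s ≠ Fin.last nL), (if lchart N μ₀ (nL := nL) t₀ s = t then ramp kL ((s : ℕ) + 1) else 0) := by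
    rw [phiL, ← Finset.sum_filter_add_sum_filter_not univ (fun s : Fin (nL + 1) => (s : ℕ) = 0)]
    have hz : ∑ s ∈ univ.filter (fun s : Fin (nL + 1) => (s : ℕ) = 0), (if lchart N μ₀ (nL := nL) t₀ s = t + 1 then ramp kL (s : ℕ) else 0) = 0 := by
      refine Finset.sum_eq_zero fun s hs => ?_
      rw [mem_filter] at hs; rw [hs.2, ramp_zero kL hk]; split_ifs <;> rfl
    rw [hz, zero_add]
    symm
    refine Finset.sum_nbij' (fun s => s + 1) (fun s => s - 1) ?_ ?_ ?_ ?_ ?_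
    · intro s hs; rw [mem_filter] at hs; rw [mem_filter, Fin.val_add_one_of_lt (Fin.lt_last_iff_ne_last.mpr hs.2)]; exact ⟨mem_univ _, by omega⟩
    · intro s hs; rw [mem_filter] at hs; rw [mem_filter]; refine ⟨mem_univ _, fun h => ?_⟩
      have h1 := congrArg Fin.val h
      rw [Fin.val_last] at h1
      have h2 : ((s - 1 : Fin (nL + 1)) : ℕ) = (s : ℕ) - 1 := by
        rw [Fin.val_sub_one_of_ne_zero (fun e => hs.2 (by rw [e, Fin.val_zero]))]
      have := s.isLt; omega
    · intro s _; simp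
    · intro s _; simp
    · intro s hs; rw [mem_filter] at hs
      rw [lchart_succ N μ₀ t₀ hs.2, Fin.val_add_one_of_lt (Fin.lt_last_iff_ne_last.mpr hs.2)]
      by_cases h : lchart N μ₀ (nL := nL) t₀ s = t
      · rw [if_pos h, if_pos (by rw [h])]
      · rw [if_neg h, if_neg (fun h' => h (add_right_cancel h'))]
  -- `phiL t`: drop `s = last`
  have h2 : phiL N μ₀ kL (nL := nL) t₀ t
      = ∑ s ∈ univ.filter (fun s : Fin (nL + 1) => s ≠ Fin.last nL), (if lchart N μ₀ (nL := nL) t₀ s = t then ramp kL (s : ℕ) else 0) := by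
    rw [phiL, ← Finset.sum_filter_add_sum_filter_not univ (fun s : Fin (nL + 1) => s ≠ Fin.last nL)]
    have hz : ∑ s ∈ univ.filter (fun s : Fin (nL + 1) => ¬ s ≠ Fin.last nL), (if lchart N μ₀ (nL := nL) t₀ s = t then ramp kL (s : ℕ) else 0) = 0 := by
      refine Finset.sum_eq_zero fun s hs => ?_
      rw [mem_filter, not_not] at hs; rw [hs.2, Fin.val_last, ramp_last kL hk hnL]; split_ifs <;> rfl
    rw [hz, add_zero]
  rw [h1, h2, ← Finset.sum_sub_distrib]
  refine Finset.sum_congr rfl fun s _ => ?_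
  split_ifs <;> ring

omit hN in
/-- `|phiL (t+1) − phiL t| ≤ 1/(k_L − 1)`. [folklore] -/
theorem abs_phiL_diff_le (hk : 2 ≤ kL) (hnL : 4 * kL = nL + 1) (hfit : nL + 1 ≤ N μ₀) (t : ZMod (N μ₀)) :
    |phiL N μ₀ kL (nL := nL) t₀ (t + 1) - phiL N μ₀ kL (nL := nL) t₀ t| ≤ 1 / ((kL : ℝ) - 1) := by
  have hk1 : (0 : ℝ) < (kL : ℝ) - 1 := by
    have : (2 : ℝ) ≤ kL := by exact_mod_cast hk
    linarith
  rw [phiL_diff N μ₀ kL t₀ hk hnL hfit t]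
  by_cases h : ∃ s ∈ univ.filter (fun s : Fin (nL + 1) => s ≠ Fin.last nL), lchart N μ₀ (nL := nL) t₀ s = t
  · obtain ⟨s, hs, hst⟩ := h
    rw [Finset.sum_eq_single_of_mem s hs (fun s' _ hne => if_neg (fun h' => hne (lchart_injective N μ₀ t₀ hfit (h'.trans hst.symm)))),
      if_pos hst]
    exact abs_ramp_sub_le kL hk _
  · push Not at h
    rw [Finset.sum_eq_zero (fun s hs => if_neg (h s hs)), abs_zero]
    exact div_nonneg zero_le_one hk1.le

omit hN in
/-- a bond where the profile changes has both ends in the zone. [folklore] -/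
theorem mem_zone_of_phiL_diff_ne (hk : 2 ≤ kL) (hnL : 4 * kL = nL + 1) (hfit : nL + 1 ≤ N μ₀) {t : ZMod (N μ₀)}
    (h : phiL N μ₀ kL (nL := nL) t₀ (t + 1) ≠ phiL N μ₀ kL (nL := nL) t₀ t) :
    t ∈ zoneL N μ₀ (nL := nL) t₀ ∧ t + 1 ∈ zoneL N μ₀ (nL := nL) t₀ := by
  have hd : phiL N μ₀ kL (nL := nL) t₀ (t + 1) - phiL N μ₀ kL (nL := nL) t₀ t ≠ 0 := sub_ne_zero.mpr h
  rw [phiL_diff N μ₀ kL t₀ hk hnL hfit t] at hd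
  obtain ⟨s, hs, hne⟩ := Finset.exists_ne_zero_of_sum_ne_zero hd
  rw [mem_filter] at hs
  have hst : lchart N μ₀ (nL := nL) t₀ s = t := by by_contra h'; exact hne (if_neg h')
  refine ⟨?_, ?_⟩
  · rw [zoneL, mem_image]; exact ⟨s, mem_univ _, hst⟩
  · rw [zoneL, mem_image]; exact ⟨s + 1, mem_univ _, by rw [lchart_succ N μ₀ t₀ hs.2, hst]⟩

omit hN in
/-- the profile is `1` on the plateau `t₀ + s`, `k_L − 1 ≤ s ≤ 3k_L`. [folklore] -/
theorem phiL_eq_one (hk : 2 ≤ kL) (hfit : nL + 1 ≤ N μ₀) {s : Fin (nL + 1)} (h1 : kL ≤ (s : ℕ) + 1) (h2 : (s : ℕ) ≤ 3 * kL) :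
    phiL N μ₀ kL (nL := nL) t₀ (lchart N μ₀ (nL := nL) t₀ s) = 1 := by
  rw [phiL_lchart N μ₀ kL t₀ hfit, ramp_eq_one kL hk h1 h2]

/-- **TUBE DECAY WITH THE LATTICE PROFILE**: `DirichletTubeDecay.tube_decay` with `φ = phiL`, `ℓ = 1/(k_L − 1)`, zone `zoneL` — the remaining
hypothesis on the field is the vanishing of the slices `t ∈ zoneL` on the transversal chart octant. [folklore] -/
theorem tube_decay_ramp (hd : 2 ≤ d) {c : ℂ} (hc : c ≠ 0) {Ω : Tor N → Prop} [DecidablePred Ω] {z : Tor N → ℂ} (hz : ∀ x, ¬ Ω x → z x = 0)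
    (σ : Fin d → Bool) (hkL : 2 ≤ kL) (hnL : 4 * kL = nL + 1) (hfit : nL + 1 ≤ N μ₀) {m : ℕ} (hm : 1 ≤ m) {n₀ : ℕ} (hn₀ : 4 * m = n₀ + 1)
    (J : ℕ) {n : ℕ} (hn : 4 * (2 ^ J * m) = n + 1) (hN' : ∀ ν, n + 1 ≤ Nsl N μ₀ ν) (b' : Tor (Nsl N μ₀))
    (hvan : ∀ t ∈ zoneL N μ₀ (nL := nL) t₀, ∀ j ∈ oct (n := n) (2 ^ J * m) σ, zsl N μ₀ z t (chart (Nsl N μ₀) b' j) = 0) :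
    ∑ t : ZMod (N μ₀), phiL N μ₀ kL (nL := nL) t₀ t ^ 2 * dirOn (univ : Finset (Fin d → Fin (n₀ + 1)))
        (zsl N μ₀ z t ∘ chart (Nsl N μ₀) (n := n₀) (shift (Nsl N μ₀) (2 * 2 ^ J * m - 2 * m) b'))
      ≤ theta d ^ J * (∑ t : ZMod (N μ₀), phiL N μ₀ kL (nL := nL) t₀ t ^ 2
            * dirOn (univ : Finset (Fin d → Fin (n + 1))) (zsl N μ₀ z t ∘ chart (Nsl N μ₀) (n := n) b')
          + 64 * (1 + 2 ^ d) * ((2 ^ J * m : ℕ) : ℝ) ^ 2 *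
            ((∑ t : ZMod (N μ₀), phiL N μ₀ kL (nL := nL) t₀ t ^ 2 * ∑ j : Fin d → Fin (n + 1),
                ‖restrictTo Ω (LapS N c *ᵥ z) (ins N μ₀ t (chart (Nsl N μ₀) b' j))‖ ^ 2) / ‖c‖ ^ 4
              + 4 * (1 / ((kL : ℝ) - 1)) ^ 2 *
                ∑ t ∈ zoneL N μ₀ (nL := nL) t₀, dirOn (univ : Finset (Fin d → Fin (n + 1))) (zsl N μ₀ z t ∘ chart (Nsl N μ₀) (n := n) b'))) :=
  tube_decay N μ₀ (phiL N μ₀ kL (nL := nL) t₀) c z σ hd hc hz (phiL_nonneg N μ₀ kL t₀ hkL hnL)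
    (abs_phiL_diff_le N μ₀ kL t₀ hkL hnL hfit) (zoneL N μ₀ (nL := nL) t₀) (fun _ h => mem_zone_of_phiL_ne_zero N μ₀ kL t₀ h)
    (fun _ h => mem_zone_of_phiL_diff_ne N μ₀ kL t₀ hkL hnL hfit h) hm hn₀ J hn hN' b' hvan

end Summit.QuantumFields.BalabanUV.T4Continuum.LongitudinalRamp

end
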